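import Summits.QuantumFields.YangMills.Theorems.UnitScaleTiltProp7ChartDatumSplit
import Literature.MathematicalPhysics.QuantumFieldTheory.Balaban1983to89.B9Eq321LandauMultiplierIffZd
import Literature.MathematicalPhysics.QuantumFieldTheory.Balaban1983to89.B8Eq151V2Divergence
import Literature.MathematicalPhysics.QuantumFieldTheory.Balaban1983to89.B8LambdaSpaceKLevel
import HarnessLib

/-!
# Route `UnitScaleTilt`, crux K1 child «MinimiserStabilityRegPr» (stmt-QuantumFields-19200), skeleton v10, stub `stub_existenceMinimalOrbit` (EX), route (α) — **(CH-KNIT v2-tw), THE (21)-ROW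
# SPLIT OF THE (CH5EL-tw) DISPLAY** (★★OWNER RULING g26-№1 (3): «its (21) part is DISPLAYED as (45)-tw `R(U₀)D*H = 0` for the `H` used + (102)»): print's restricted Landau condition
# (21) ∕ (1.38) `IsLandauPrint U₀ X` for the chart exponent `X = (1∕i)(A′ − HD(A′))`, `A′ = iη·ι(A₁ + H₁B)`, is a ℂ-LINEAR condition on the exponent, so it follows — by closure under
# sums and scalars — from three print identities about the LINEAR letters: (102) «`RD*𝔊 = 0`» (`𝔊 = G₁𝔓*`, [Balaban1985BackgroundPropagators] (3.147)–(3.153)), (3.124) «`RD*G₁Q* = 0`» for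
# `H₁ = G₁Q*(QG₁Q*)⁻¹` ((129)), and (45) «`RD*H = 0`» for the chart's `H`.  After this file the XL display of the knit no longer carries (21).

Cell `ym3-torus`, width seat `ym-ust-19200-w2` (gen 3; KNIT RULER).  THEOREMS ONLY (0 `def`, 0 `sorry`).  Bookkeeping ∕ linear algebra: nothing here closes the stub; `--supports
stmt-QuantumFields-19200 --as helper`, count-neutral.  YM₃ on T³ is a ladder rung (R3), not the Clay problem; nothing here claims the stub, the crux, d = 4 or the mass gap.

THE PRINT.  [Balaban1985Variational] p. 285: «H is a linear operator … satisfying QH = I, RD*H = 0 (45)»; p. 289 (76): «the configuration A given by (47) satisfies also the second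
condition in (21) if RD*A′ = 0 because RD*HD(A′) = 0»; p. 293–294: «(102) Q A₁ = 0, RD* A₁ = 0 … A′ = A₁ + H₁B (103) … the operator 𝔊 … satisfying the equalities Q𝔊 = 0, RD*𝔊 = 0»;
[Balaban1985BackgroundPropagators] p. 425: «Q𝔓 = 0, RD*𝔓 = 0 … we need to know only the identities (3.124) and RD*G₁DR = R», (3.124): «QG₁DR = 0, RD*G₁Q* = 0»; [Balaban1985RegularSpaces]
(1.38) p. 82: the restricted Landau condition in multiplier form (tree: `B8Eq138LandauZd.IsLandau138` — «`Δ_{U₀}↾Ω₀(D*_{U₀}A) = Q′(U₀)ᵀμ` for some multiplier `μ`»).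

WHAT IS PROVED (sorry-free, no definition; `ι` the inline (115)-dictionary of `Prop7ChartDatumSplit`).  §1 the multiplier form (1.38) is a ℂ-SUBSPACE condition at EVERY background
(`isLandau138_add`, `isLandau138_smul`; the flat case is ★`B8Ineq159FlatCubeMemberPerCube.isLandau138_flat_add∕_smul`) and so is the route's based reading `IsLandauPrint`
(`isLandauPrint_add`, `isLandauPrint_smul`, `isLandauPrint_sub`).  §2 ★ **`isLandauPrint_of_split`** — (21) for `X` with `iX = A′ − H(D A′)`, `A′ = iη·ι(A₁ + H₁ Bsym)`, `A₁` a
solution of (111), FROM the three rows (102)-L `∀ f, IsLandauPrint U₀ (ι(𝔊f))`, (129)-L `∀ B, IsLandauPrint U₀ (ι(H₁B))`, (45)-tw `∀ Y, IsLandauPrint U₀ (HY)`.  §3 ★★ **`hXtw'_of_splitL`**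
— the (CH5EL-tw)′ display `hXtw′` of `Prop7StubEXOfChartPiecesTwEta ∕ …TwP3` (∃ X: Hermitian-traceless, chart identity, (19)-size, (21), E–L) FROM the thinner display `hXtw″` (the same
WITHOUT (21)) and the three rows.  HONEST SCOPE: linear-algebra bookkeeping; the XL content ((112) ∘ Prop. 5 ∘ (123)–(140) ∘ E–L) stays displayed; (102)-L ∕ (129)-L ∕ (45)-tw are print's
identities about the opaque letters `𝔊(U₀)`, `H₁(U₀)` and the chart's `H` (suppliers: `B11Eq111FrakG.apply_RDstar_frakGLin`, (3.124), and the (45) clause of [Balaban1985BackgroundPropagators]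
Thm 3.12's `H` — N06-class letters, same storey as `norm_G` ∕ `norm_H₁` ∕ (46)-tw).

References: T. Bałaban, CMP 102 (1985) 277–309 [Balaban1985Variational] ((21) p.281, (45)–(47) p.285, (76) p.289, (102)–(103) p.293, (111)–(112) p.294, (129) p.297); CMP 99
(1985) 389–434 [Balaban1985BackgroundPropagators] ((3.124) p.420, (3.147)–(3.153) pp.425–426, (3.23)–(3.25) p.394); CMP 99 (1985) 75–102 [Balaban1985RegularSpaces] ((1.38) p.82).
-/

set_option autoImplicit false

noncomputable section

open scoped Matrix.Norms.L2Operator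

namespace Summit.QuantumFields.YangMills.Theorems.Prop7ChartLandauSplit

open NormedSpace
open Literature.MathematicalPhysics.QuantumFieldTheory.Balaban1983to89
open Literature.MathematicalPhysics.QuantumFieldTheory.Balaban1983to89.T3ContinuumYM3Torus
open Literature.MathematicalPhysics.QuantumFieldTheory.Balaban1983to89.T3UnitLawDensityEML (ℰp)
open Literature.MathematicalPhysics.QuantumFieldTheory.Balaban1983to89.T3TiltDescent (descendTo)
open Literature.MathematicalPhysics.QuantumFieldTheory.Balaban1983to89.T3ConstrainedMinimiser (fibre)
open Literature.MathematicalPhysics.QuantumFieldTheory.Balaban1983to89.T3SectALandauChart (emb15 eta eta_pos)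
open B7Prop1Explicit renaming Site → LSite
open B8Eq138LandauZd (IsLandau138 covDivB covLap QT)
open B9SectCLatticeCarrier (Bond)
open B10Eq27TorusAxialLog (pull unitsField toUField)
open B11Eq115Space (NegSize Space115 JetSup)
open B11Eq111FrakG (nabla115)
open B11Eq98CurrentSlot (Jcur)
open B11Prop3Model (Dfix)
open MatrixLog (mlog)
open Summit.QuantumFields.YangMills.Theorems.Prop7TPrint (nMax19 expHermField)
open Summit.QuantumFields.YangMills.Theorems.Prop7SPrint (basePt IsLandauPrint RestrictedPrint)
open Summit.QuantumFields.YangMills.Theorems.Prop7SectET3Transport (periodsT3 bgOfCfg bondEquiv)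
open Summit.QuantumFields.YangMills.Theorems.Prop7SymAvgTw (QTw CmapTw)

/-! ## §1 (1.38) in multiplier form is a ℂ-subspace condition at every background; so is `IsLandauPrint` -/

section Linear

variable {d : ℕ} {𝔸 : Type*} [NormedRing 𝔸] [NormedAlgebra ℂ 𝔸] [CompleteSpace 𝔸]

omit [CompleteSpace 𝔸] in
/-- The backward divergence `D^{η*}_{U₀}` (3.24) is additive (any background). [cite: Balaban1985BackgroundPropagators, (3.23)–(3.24) p.394] -/
theorem covDivB_add_bg (η : ℝ) (U₀ : LSite d → Fin d → 𝔸ˣ) (A B : LSite d → Fin d → 𝔸) (x : LSite d) :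
    covDivB η U₀ (A + B) x = covDivB η U₀ A x + covDivB η U₀ B x := by
  simp only [covDivB, ← Finset.sum_add_distrib]
  refine Finset.sum_congr rfl fun μ _ => ?_
  have h : (fun z => (A + B) z μ) = (fun z => A z μ) + fun z => B z μ := rfl
  rw [h, B8Eq143PlaqExpansion.covDeriv_add]

omit [CompleteSpace 𝔸] in
/-- The backward divergence `D^{η*}_{U₀}` (3.24) is `ℂ`-homogeneous (any background). [cite: Balaban1985BackgroundPropagators, (3.23)–(3.24) p.394] -/
theorem covDivB_smul_bg (η : ℝ) (U₀ : LSite d → Fin d → 𝔸ˣ) (c : ℂ) (A : LSite d → Fin d → 𝔸) (x : LSite d) :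
    covDivB η U₀ (c • A) x = c • covDivB η U₀ A x := by
  simp only [covDivB, Finset.smul_sum]
  refine Finset.sum_congr rfl fun μ _ => ?_
  have h : (fun z => (c • A) z μ) = c • fun z => A z μ := rfl
  rw [h, B8Eq146AExpansion.covDeriv_smul]

omit [CompleteSpace 𝔸] in
/-- The covariant Laplacian `Δ^η_{U₀}` (3.23) is additive (any background). [cite: Balaban1985BackgroundPropagators, (3.23) p.394] -/
theorem covLap_add_bg (η : ℝ) (U₀ : LSite d → Fin d → 𝔸ˣ) (f g : LSite d → 𝔸) (x : LSite d) :
    covLap η U₀ (f + g) x = covLap η U₀ f x + covLap η U₀ g x := by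
  unfold covLap
  have h : (fun z μ => B8Ineq132.covDerivFwd η U₀ μ (f + g) z) =
      (fun z μ => B8Ineq132.covDerivFwd η U₀ μ f z) + fun z μ => B8Ineq132.covDerivFwd η U₀ μ g z := by
    funext z μ
    exact B8LambdaSpaceKLevel.covDerivFwd_add' η U₀ μ f g z
  rw [h, covDivB_add_bg]

omit [CompleteSpace 𝔸] in
/-- The covariant Laplacian `Δ^η_{U₀}` (3.23) is `ℂ`-homogeneous (any background). [cite: Balaban1985BackgroundPropagators, (3.23) p.394] -/
theorem covLap_smul_bg (η : ℝ) (U₀ : LSite d → Fin d → 𝔸ˣ) (c : ℂ) (f : LSite d → 𝔸) (x : LSite d) :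
    covLap η U₀ (c • f) x = c • covLap η U₀ f x := by
  unfold covLap
  have h : (fun z μ => B8Ineq132.covDerivFwd η U₀ μ (c • f) z) = c • fun z μ => B8Ineq132.covDerivFwd η U₀ μ f z := by
    funext z μ
    exact B8Eq151V2Divergence.covDerivFwd_smul η U₀ μ c f z
  rw [h, covDivB_smul_bg]

/-- ★ **(1.38) IS CLOSED UNDER ADDITION AT EVERY BACKGROUND** (multiplier form: add the multipliers; the flat case is `B8Ineq159FlatCubeMemberPerCube.isLandau138_flat_add`).
[cite: Balaban1985RegularSpaces, (1.38) p.82; Balaban1985BackgroundPropagators, (3.24)–(3.25) p.394] -/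
theorem isLandau138_add {L m : ℕ} {η : ℝ} {Ω₀ : Set (LSite d)} {Λs : ℕ → Set (LSite d)} {U₀ : LSite d → Fin d → 𝔸ˣ} {A B : LSite d → Fin d → 𝔸}
    (hA : IsLandau138 L m η Ω₀ Λs U₀ A) (hB : IsLandau138 L m η Ω₀ Λs U₀ B) : IsLandau138 L m η Ω₀ Λs U₀ (A + B) := by
  obtain ⟨μ₁, h₁⟩ := hA
  obtain ⟨μ₂, h₂⟩ := hB
  refine ⟨μ₁ + μ₂, fun x hx => ?_⟩
  have hind : Ω₀.indicator (covDivB η U₀ (A + B)) = Ω₀.indicator (covDivB η U₀ A) + Ω₀.indicator (covDivB η U₀ B) := by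
    have h : covDivB η U₀ (A + B) = covDivB η U₀ A + covDivB η U₀ B := funext fun y => covDivB_add_bg η U₀ A B y
    rw [h, Set.indicator_add']
  rw [hind, covLap_add_bg, B9Eq321LandauMultiplierIffZd.QT_add, h₁ x hx, h₂ x hx]

/-- ★ **(1.38) IS CLOSED UNDER COMPLEX SCALARS AT EVERY BACKGROUND.** [cite: Balaban1985RegularSpaces, (1.38) p.82; Balaban1985BackgroundPropagators, (3.24)–(3.25) p.394] -/
theorem isLandau138_smul {L m : ℕ} {η : ℝ} {Ω₀ : Set (LSite d)} {Λs : ℕ → Set (LSite d)} {U₀ : LSite d → Fin d → 𝔸ˣ} {A : LSite d → Fin d → 𝔸}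
    (c : ℂ) (hA : IsLandau138 L m η Ω₀ Λs U₀ A) : IsLandau138 L m η Ω₀ Λs U₀ (c • A) := by
  obtain ⟨μ, h⟩ := hA
  refine ⟨c • μ, fun x hx => ?_⟩
  have hind : Ω₀.indicator (covDivB η U₀ (c • A)) = c • Ω₀.indicator (covDivB η U₀ A) := by
    have h' : covDivB η U₀ (c • A) = c • covDivB η U₀ A := funext fun y => covDivB_smul_bg η U₀ c A y
    rw [h']
    funext y
    by_cases hy : y ∈ Ω₀
    · simp only [Set.indicator_of_mem hy, Pi.smul_apply]
    · simp only [Set.indicator_of_notMem hy, Pi.smul_apply, smul_zero]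
  rw [hind, covLap_smul_bg, B9Eq321LandauMultiplierIffZd.QT_smul, h x hx]

end Linear

section Print

variable (F : T3Family) {n K : ℕ}

/-- **THE ROUTE's (21) ∕ (1.38) `IsLandauPrint U₀` IS CLOSED UNDER ADDITION** (the based pullback and the scaling `η⁻¹` are linear). [cite: Balaban1985Variational, (21) p.281; Balaban1985RegularSpaces, (1.38) p.82] -/
theorem isLandauPrint_add {U₀ : GaugeField (F.P K) 0 (Matrix.specialUnitaryGroup (Fin 2) ℂ)} {X Y : PBond (F.P K) 0 → Matrix (Fin 2) (Fin 2) ℂ}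
    (hX : IsLandauPrint F n K U₀ X) (hY : IsLandauPrint F n K U₀ Y) : IsLandauPrint F n K U₀ (X + Y) := by
  unfold IsLandauPrint at hX hY ⊢
  have h : pull (fun b => (eta F n K)⁻¹ • (X + Y) b) (basePt F n K)
      = pull (fun b => (eta F n K)⁻¹ • X b) (basePt F n K) + pull (fun b => (eta F n K)⁻¹ • Y b) (basePt F n K) := by
    funext z μ
    simp only [B10Eq27TorusAxialLog.pull_apply, Pi.add_apply, smul_add]
  rw [h]
  exact isLandau138_add hX hY

/-- **`IsLandauPrint U₀` IS CLOSED UNDER COMPLEX SCALARS.** [cite: Balaban1985Variational, (21) p.281; Balaban1985RegularSpaces, (1.38) p.82] -/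
theorem isLandauPrint_smul {U₀ : GaugeField (F.P K) 0 (Matrix.specialUnitaryGroup (Fin 2) ℂ)} {X : PBond (F.P K) 0 → Matrix (Fin 2) (Fin 2) ℂ}
    (c : ℂ) (hX : IsLandauPrint F n K U₀ X) : IsLandauPrint F n K U₀ (c • X) := by
  unfold IsLandauPrint at hX ⊢
  have h : pull (fun b => (eta F n K)⁻¹ • (c • X) b) (basePt F n K) = c • pull (fun b => (eta F n K)⁻¹ • X b) (basePt F n K) := by
    funext z μ
    simp only [B10Eq27TorusAxialLog.pull_apply, Pi.smul_apply, smul_comm c]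
  rw [h]
  exact isLandau138_smul c hX

/-- `IsLandauPrint U₀` is closed under subtraction. [cite: Balaban1985Variational, (21) p.281] -/
theorem isLandauPrint_sub {U₀ : GaugeField (F.P K) 0 (Matrix.specialUnitaryGroup (Fin 2) ℂ)} {X Y : PBond (F.P K) 0 → Matrix (Fin 2) (Fin 2) ℂ}
    (hX : IsLandauPrint F n K U₀ X) (hY : IsLandauPrint F n K U₀ Y) : IsLandauPrint F n K U₀ (X - Y) := by
  have h : X - Y = X + (-1 : ℂ) • Y := by rw [neg_one_smul, sub_eq_add_neg]
  rw [h]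
  exact isLandauPrint_add F hX (isLandauPrint_smul F (-1) hY)

end Print

/-! ## §2 (21) for the chart exponent from (102)-L «RD*𝔊 = 0», (129)-L «RD*H₁ = 0», (45)-tw «RD*H = 0» -/

section Split

variable (F : T3Family) {n K : ℕ} (h : n ≤ K) [Fact (0 < (F.L : ℝ))] [Fact (0 < ((F.L : ℝ)⁻¹) ^ (K - n))]
  {V : GaugeField (F.P n) 0 (Matrix.specialUnitaryGroup (Fin 2) ℂ)} {U₀ : GaugeField (F.P K) 0 (Matrix.specialUnitaryGroup (Fin 2) ℂ)}
  {𝒢 : NegSize (F.L : ℝ) (((F.L : ℝ)⁻¹) ^ (K - n)) (fun _ : Bond 3 (periodsT3 F K) => K - n) 3 (Matrix (Fin 2) (Fin 2) ℂ) →L[ℂ]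
        Space115 (F.L : ℝ) (((F.L : ℝ)⁻¹) ^ (K - n)) (fun _ : Bond 3 (periodsT3 F K) => K - n) (fun _ : Bond 3 (periodsT3 F K) × Fin 3 => K - n)
          (nabla115 (((F.L : ℝ)⁻¹) ^ (K - n)) (bgOfCfg F K U₀))}
  {W : Space115 (F.L : ℝ) (((F.L : ℝ)⁻¹) ^ (K - n)) (fun _ : Bond 3 (periodsT3 F K) => K - n) (fun _ : Bond 3 (periodsT3 F K) × Fin 3 => K - n)
          (nabla115 (((F.L : ℝ)⁻¹) ^ (K - n)) (bgOfCfg F K U₀)) →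
        NegSize (F.L : ℝ) (((F.L : ℝ)⁻¹) ^ (K - n)) (fun _ : Bond 3 (periodsT3 F K) => K - n) 3 (Matrix (Fin 2) (Fin 2) ℂ)}
  {H₁ : (PBond (F.P n) 0 → Matrix (Fin 2) (Fin 2) ℂ) →L[ℂ]
        Space115 (F.L : ℝ) (((F.L : ℝ)⁻¹) ^ (K - n)) (fun _ : Bond 3 (periodsT3 F K) => K - n) (fun _ : Bond 3 (periodsT3 F K) × Fin 3 => K - n)
          (nabla115 (((F.L : ℝ)⁻¹) ^ (K - n)) (bgOfCfg F K U₀))}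
  {H : (PBond (F.P n) 0 → Matrix (Fin 2) (Fin 2) ℂ) →ₗ[ℂ] (PBond (F.P K) 0 → Matrix (Fin 2) (Fin 2) ℂ)}

/-- ★ **(21) FOR THE CHART EXPONENT FROM THREE PRINT IDENTITIES**: let `A₁` solve (111) (so `A₁ ∈ range 𝔊`), `A′ := iη·ι(A₁ + H₁ Bsym)` ((103), exponent scale) and `iX = A′ − H(D A′)` ((47)∕(112)).
If (102) «`RD*𝔊 = 0`», (3.124)∕(129) «`RD*H₁ = 0`» and (45) «`RD*H = 0`» hold in the route's form `IsLandauPrint U₀ (·)` of (1.38) (DISPLAYED rows, read through `ι`), then `IsLandauPrint U₀ X` —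
print p. 289 (76): «the configuration A given by (47) satisfies also the second condition in (21) if RD*A′ = 0 because RD*HD(A′) = 0».
[cite: Balaban1985Variational, (21) p.281, (45)–(47) p.285, (76) p.289, (102)–(103) p.293, (111)–(112) p.294; Balaban1985BackgroundPropagators, (3.124) p.420, (3.147) p.425] -/
theorem isLandauPrint_of_split {D : PBond (F.P n) 0 → Matrix (Fin 2) (Fin 2) ℂ}
    (h102L : ∀ f : NegSize (F.L : ℝ) (((F.L : ℝ)⁻¹) ^ (K - n)) (fun _ : Bond 3 (periodsT3 F K) => K - n) 3 (Matrix (Fin 2) (Fin 2) ℂ),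
      IsLandauPrint F n K U₀ (fun b : PBond (F.P K) 0 => JetSup.equiv _ _ _ (𝒢 f) (bondEquiv F K b)))
    (h129L : ∀ B : PBond (F.P n) 0 → Matrix (Fin 2) (Fin 2) ℂ,
      IsLandauPrint F n K U₀ (fun b : PBond (F.P K) 0 => JetSup.equiv _ _ _ (H₁ B) (bondEquiv F K b)))
    (h45 : ∀ Y : PBond (F.P n) 0 → Matrix (Fin 2) (Fin 2) ℂ, IsLandauPrint F n K U₀ (H Y))
    (A₁ : Space115 (F.L : ℝ) (((F.L : ℝ)⁻¹) ^ (K - n)) (fun _ : Bond 3 (periodsT3 F K) => K - n) (fun _ : Bond 3 (periodsT3 F K) × Fin 3 => K - n)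
      (nabla115 (((F.L : ℝ)⁻¹) ^ (K - n)) (bgOfCfg F K U₀)))
    (h111 : A₁ + 𝒢 (Jcur (bgOfCfg F K U₀)) + 𝒢 (W (A₁ + H₁ (fun c : PBond (F.P n) 0 =>
        (-Complex.I) • mlog (((V c : Matrix.specialUnitaryGroup (Fin 2) ℂ) : Matrix (Fin 2) (Fin 2) ℂ)
          * star ((descendTo F ℰp n K h U₀ c : Matrix.specialUnitaryGroup (Fin 2) ℂ) : Matrix (Fin 2) (Fin 2) ℂ))))) = 0)
    {X : PBond (F.P K) 0 → Matrix (Fin 2) (Fin 2) ℂ}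
    (hAX : (((eta F n K : ℝ) : ℂ) * Complex.I) • ((fun b : PBond (F.P K) 0 => JetSup.equiv _ _ _ A₁ (bondEquiv F K b))
              + (fun b : PBond (F.P K) 0 => JetSup.equiv _ _ _ (H₁ (fun c : PBond (F.P n) 0 =>
                  (-Complex.I) • mlog (((V c : Matrix.specialUnitaryGroup (Fin 2) ℂ) : Matrix (Fin 2) (Fin 2) ℂ)
                    * star ((descendTo F ℰp n K h U₀ c : Matrix.specialUnitaryGroup (Fin 2) ℂ) : Matrix (Fin 2) (Fin 2) ℂ)))) (bondEquiv F K b)))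
            - H D = fun b => Complex.I • X b) :
    IsLandauPrint F n K U₀ X := by
  set B : PBond (F.P n) 0 → Matrix (Fin 2) (Fin 2) ℂ := fun c =>
    (-Complex.I) • mlog (((V c : Matrix.specialUnitaryGroup (Fin 2) ℂ) : Matrix (Fin 2) (Fin 2) ℂ)
      * star ((descendTo F ℰp n K h U₀ c : Matrix.specialUnitaryGroup (Fin 2) ℂ) : Matrix (Fin 2) (Fin 2) ℂ)) with hB
  -- `A₁` is in the range of `𝔊` ((111)), so (102) applies to it
  have hA₁ : A₁ = 𝒢 (-(Jcur (bgOfCfg F K U₀) + W (A₁ + H₁ B))) := by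
    rw [map_neg, map_add]
    exact eq_neg_of_add_eq_zero_left (by rw [← add_assoc]; exact h111)
  have hL1 : IsLandauPrint F n K U₀ (fun b : PBond (F.P K) 0 => JetSup.equiv _ _ _ A₁ (bondEquiv F K b)) := by
    rw [hA₁]; exact h102L _
  -- the chart parameter `A′` and the chart image `A′ − H D` satisfy (21)
  have hA' : IsLandauPrint F n K U₀ ((((eta F n K : ℝ) : ℂ) * Complex.I) • ((fun b : PBond (F.P K) 0 => JetSup.equiv _ _ _ A₁ (bondEquiv F K b))
      + (fun b : PBond (F.P K) 0 => JetSup.equiv _ _ _ (H₁ B) (bondEquiv F K b)))) :=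
    isLandauPrint_smul F _ (isLandauPrint_add F hL1 (h129L B))
  have himg := isLandauPrint_sub F hA' (h45 D)
  rw [hAX] at himg
  -- `X = (−i)·(iX)`
  have hX : X = (-Complex.I) • fun b => Complex.I • X b := by
    funext b
    rw [Pi.smul_apply, smul_smul, show -Complex.I * Complex.I = 1 by rw [neg_mul, Complex.I_mul_I, neg_neg], one_smul]
  rw [hX]
  exact isLandauPrint_smul F _ himg

/-! ## §3 The knit's (CH5EL-tw)′ display from the thinner display without (21) -/

/-- ★★ **THE (CH5EL-tw)′ DISPLAY `hXtw′` OF `Prop7StubEXOfChartPiecesTwEta.stubEX_of_chartPiecesTwEta` ∕ `…TwP3` FROM THE THINNER DISPLAY `hXtw″` AND THE ROWS (102)-L ∕ (129)-L ∕ (45)-tw**: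
`hXtw″` delivers, for every solution `A₁` of (111) in the (115)-ball, an exponent `X` — Hermitian-traceless, chart identity `A′ − H(DA′) = iX` at `A′ = iη·ι(A₁ + H₁ Bsym)`, (19)-size, E–L —
and (21) `IsLandauPrint U₀ X` is SUPPLIED by `isLandauPrint_of_split`.  After this lemma the XL row of the EX knit reads: (112) ∘ Prop. 5 (reality) ∘ (123)–(140) ((19)-size) ∘ E–L.
[cite: Balaban1985Variational, (21) p.281, (76) p.289, (102)–(103) p.293, (112) p.294, Prop. 5 p.294, (123)–(140) pp.296–299] -/
theorem hXtw'_of_splitL {ε₄ M C₂ : ℝ}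
    (h102L : ∀ f : NegSize (F.L : ℝ) (((F.L : ℝ)⁻¹) ^ (K - n)) (fun _ : Bond 3 (periodsT3 F K) => K - n) 3 (Matrix (Fin 2) (Fin 2) ℂ),
      IsLandauPrint F n K U₀ (fun b : PBond (F.P K) 0 => JetSup.equiv _ _ _ (𝒢 f) (bondEquiv F K b)))
    (h129L : ∀ B : PBond (F.P n) 0 → Matrix (Fin 2) (Fin 2) ℂ,
      IsLandauPrint F n K U₀ (fun b : PBond (F.P K) 0 => JetSup.equiv _ _ _ (H₁ B) (bondEquiv F K b)))
    (h45 : ∀ Y : PBond (F.P n) 0 → Matrix (Fin 2) (Fin 2) ℂ, IsLandauPrint F n K U₀ (H Y))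
    -- the thinner display: (112) ∘ Prop. 5 ∘ (123)–(140) ∘ E–L, WITHOUT (21)
    (hXtw'' : ∀ A₁ : Space115 (F.L : ℝ) (((F.L : ℝ)⁻¹) ^ (K - n)) (fun _ : Bond 3 (periodsT3 F K) => K - n) (fun _ : Bond 3 (periodsT3 F K) × Fin 3 => K - n)
            (nabla115 (((F.L : ℝ)⁻¹) ^ (K - n)) (bgOfCfg F K U₀)),
      ‖A₁‖ < ε₄ → A₁ + 𝒢 (Jcur (bgOfCfg F K U₀)) + 𝒢 (W (A₁ + H₁ (fun c : PBond (F.P n) 0 =>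
        (-Complex.I) • mlog (((V c : Matrix.specialUnitaryGroup (Fin 2) ℂ) : Matrix (Fin 2) (Fin 2) ℂ)
          * star ((descendTo F ℰp n K h U₀ c : Matrix.specialUnitaryGroup (Fin 2) ℂ) : Matrix (Fin 2) (Fin 2) ℂ))))) = 0 →
        ∃ X : PBond (F.P K) 0 → Matrix (Fin 2) (Fin 2) ℂ,
          (∀ b : PBond (F.P K) 0, (X b).IsHermitian ∧ Matrix.trace (X b) = 0) ∧
          (((eta F n K : ℝ) : ℂ) * Complex.I) • ((fun b : PBond (F.P K) 0 => JetSup.equiv _ _ _ A₁ (bondEquiv F K b))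
              + (fun b : PBond (F.P K) 0 => JetSup.equiv _ _ _ (H₁ (fun c : PBond (F.P n) 0 =>
                  (-Complex.I) • mlog (((V c : Matrix.specialUnitaryGroup (Fin 2) ℂ) : Matrix (Fin 2) (Fin 2) ℂ)
                    * star ((descendTo F ℰp n K h U₀ c : Matrix.specialUnitaryGroup (Fin 2) ℂ) : Matrix (Fin 2) (Fin 2) ℂ)))) (bondEquiv F K b)))
            - H (Dfix (CmapTw F n K h U₀) H C₂
              ((((eta F n K : ℝ) : ℂ) * Complex.I) • ((fun b : PBond (F.P K) 0 => JetSup.equiv _ _ _ A₁ (bondEquiv F K b))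
              + (fun b : PBond (F.P K) 0 => JetSup.equiv _ _ _ (H₁ (fun c : PBond (F.P n) 0 =>
                  (-Complex.I) • mlog (((V c : Matrix.specialUnitaryGroup (Fin 2) ℂ) : Matrix (Fin 2) (Fin 2) ℂ)
                    * star ((descendTo F ℰp n K h U₀ c : Matrix.specialUnitaryGroup (Fin 2) ℂ) : Matrix (Fin 2) (Fin 2) ℂ)))) (bondEquiv F K b)))))
            = (fun b => Complex.I • X b) ∧
          nMax19 F n K U₀ X ≤ M * (‖A₁‖ + ‖H₁ (fun c : PBond (F.P n) 0 =>
            (-Complex.I) • mlog (((V c : Matrix.specialUnitaryGroup (Fin 2) ℂ) : Matrix (Fin 2) (Fin 2) ℂ)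
              * star ((descendTo F ℰp n K h U₀ c : Matrix.specialUnitaryGroup (Fin 2) ℂ) : Matrix (Fin 2) (Fin 2) ℂ)))‖) ∧
          (∀ u : GaugeTransf (F.P K) 0 (Matrix.specialUnitaryGroup (Fin 2) ℂ), RestrictedPrint F n K U₀ u →
            GaugeField.gaugeAct u (emb15 U₀ (expHermField X)) ∈ fibre F ℰp n K h V →
            ∀ γ : ℝ → GaugeField (F.P K) 0 (Matrix.specialUnitaryGroup (Fin 2) ℂ), γ 0 = GaugeField.gaugeAct u (emb15 U₀ (expHermField X)) →
              (∀ t, γ t ∈ fibre F ℰp n K h V) →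
              (∀ b, DifferentiableAt ℝ (fun t => ((γ t b : Matrix.specialUnitaryGroup (Fin 2) ℂ) : Matrix (Fin 2) (Fin 2) ℂ)) 0) →
                deriv (fun t => wilsonAction4 (γ t)) 0 = 0)) :
    ∀ A₁ : Space115 (F.L : ℝ) (((F.L : ℝ)⁻¹) ^ (K - n)) (fun _ : Bond 3 (periodsT3 F K) => K - n) (fun _ : Bond 3 (periodsT3 F K) × Fin 3 => K - n)
          (nabla115 (((F.L : ℝ)⁻¹) ^ (K - n)) (bgOfCfg F K U₀)),
      ‖A₁‖ < ε₄ → A₁ + 𝒢 (Jcur (bgOfCfg F K U₀)) + 𝒢 (W (A₁ + H₁ (fun c : PBond (F.P n) 0 =>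
        (-Complex.I) • mlog (((V c : Matrix.specialUnitaryGroup (Fin 2) ℂ) : Matrix (Fin 2) (Fin 2) ℂ)
          * star ((descendTo F ℰp n K h U₀ c : Matrix.specialUnitaryGroup (Fin 2) ℂ) : Matrix (Fin 2) (Fin 2) ℂ))))) = 0 →
        ∃ X : PBond (F.P K) 0 → Matrix (Fin 2) (Fin 2) ℂ,
          (∀ b : PBond (F.P K) 0, (X b).IsHermitian ∧ Matrix.trace (X b) = 0) ∧
          (((eta F n K : ℝ) : ℂ) * Complex.I) • ((fun b : PBond (F.P K) 0 => JetSup.equiv _ _ _ A₁ (bondEquiv F K b))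
              + (fun b : PBond (F.P K) 0 => JetSup.equiv _ _ _ (H₁ (fun c : PBond (F.P n) 0 =>
                  (-Complex.I) • mlog (((V c : Matrix.specialUnitaryGroup (Fin 2) ℂ) : Matrix (Fin 2) (Fin 2) ℂ)
                    * star ((descendTo F ℰp n K h U₀ c : Matrix.specialUnitaryGroup (Fin 2) ℂ) : Matrix (Fin 2) (Fin 2) ℂ)))) (bondEquiv F K b)))
            - H (Dfix (CmapTw F n K h U₀) H C₂
              ((((eta F n K : ℝ) : ℂ) * Complex.I) • ((fun b : PBond (F.P K) 0 => JetSup.equiv _ _ _ A₁ (bondEquiv F K b))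
              + (fun b : PBond (F.P K) 0 => JetSup.equiv _ _ _ (H₁ (fun c : PBond (F.P n) 0 =>
                  (-Complex.I) • mlog (((V c : Matrix.specialUnitaryGroup (Fin 2) ℂ) : Matrix (Fin 2) (Fin 2) ℂ)
                    * star ((descendTo F ℰp n K h U₀ c : Matrix.specialUnitaryGroup (Fin 2) ℂ) : Matrix (Fin 2) (Fin 2) ℂ)))) (bondEquiv F K b)))))
            = (fun b => Complex.I • X b) ∧
          nMax19 F n K U₀ X ≤ M * (‖A₁‖ + ‖H₁ (fun c : PBond (F.P n) 0 =>
            (-Complex.I) • mlog (((V c : Matrix.specialUnitaryGroup (Fin 2) ℂ) : Matrix (Fin 2) (Fin 2) ℂ)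
              * star ((descendTo F ℰp n K h U₀ c : Matrix.specialUnitaryGroup (Fin 2) ℂ) : Matrix (Fin 2) (Fin 2) ℂ)))‖) ∧
          IsLandauPrint F n K U₀ X ∧
          (∀ u : GaugeTransf (F.P K) 0 (Matrix.specialUnitaryGroup (Fin 2) ℂ), RestrictedPrint F n K U₀ u →
            GaugeField.gaugeAct u (emb15 U₀ (expHermField X)) ∈ fibre F ℰp n K h V →
            ∀ γ : ℝ → GaugeField (F.P K) 0 (Matrix.specialUnitaryGroup (Fin 2) ℂ), γ 0 = GaugeField.gaugeAct u (emb15 U₀ (expHermField X)) →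
              (∀ t, γ t ∈ fibre F ℰp n K h V) →
              (∀ b, DifferentiableAt ℝ (fun t => ((γ t b : Matrix.specialUnitaryGroup (Fin 2) ℂ) : Matrix (Fin 2) (Fin 2) ℂ)) 0) →
                deriv (fun t => wilsonAction4 (γ t)) 0 = 0) := by
  intro A₁ hA₁ h111
  obtain ⟨X, hX, hAX, hsize, hEL⟩ := hXtw'' A₁ hA₁ h111
  exact ⟨X, hX, hAX, hsize, isLandauPrint_of_split F h h102L h129L h45 A₁ h111 hAX, hEL⟩

end Split

end Summit.QuantumFields.YangMills.Theorems.Prop7ChartLandauSplit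

end
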